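import Summits.BirchSwinnertonDyer.BirchSwinnertonDyer.Theorems.PrintX9MuPartStubH5bAtSOfClauseZero
import HarnessLib

/-!
# `Stmt.h5bAtS` of the shared μ-crux, ONE FRAME AT A TIME, from its level-`0` clause above `p` on that frame

Summits-side helper for the line `spec_witnesses` on the shared μ-crux `MuInequalityCoherentPairOfPrint`
(stmt-BirchSwinnertonDyer-23237, skeleton v6/v7, registered stub `stub_h5bAtS : Stmt.h5bAtS`); cell `pub/bsd-print-x9`,
seat `bsd-line-x10b-p1-w8` g3 (the `k = 0` assembler lineage of D1).  `--supports` stmt-BirchSwinnertonDyer-23237.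
THEOREMS ONLY (no definition, no named fact, no instance, no `sorry`).  Companion of
`PrintX9MuPartStubH5bAtSOfClauseZero` (`HeegnerMuPartH5bAtS.h5bAtS_of_clauseZeroP : Stmt.h5bAtSZeroP → Stmt.h5bAtS`, all
frames at once): the SAME reduction for ONE frame `(N, W, K, p, κ, γ, hyp, S, …)` of the μ-letter, so that partial results
which hold only on SOME frames (e.g. the non-anomalous `v ∣ p` clause of x10b-p1-w8 g2, p668203) yield the frame's instance
of `Stmt.h5bAtS`:
* **`h5bAtS_frame_of_clauseZeroP`** — on a fixed frame, if every `v ∈ S` with `p ∈ v` has a threshold `m₁` beyond which the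
  tower-level-`0` clause `(θ_v ∘ transport_v)(F̄_0(σ v)) = F̄_0(v)` holds for all the data of the canonical Eisenstein setting,
  then the frame's instance of `Stmt.h5bAtS` holds (one `m₅`, all data, all levels `k`, all `v ∈ S`): `v ∤ p` by
  `eisensteinDVRSetting_exists_forall_h5b_clause_zero_of_not_mem` (x9-p2's `hdec` from (Heeg), `ZpExtension.toAdd_conjGalCMH_eq_neg`),
  all `k` by `eisensteinDVRSetting_h5b_hfin_of_zero`.
HONEST FRAMING: the `v ∣ p` clause is NOT proved here; no summit statement is proved; the μ-crux is not asserted; BSD is not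
proved by any of this.

References: [Howard2004HeegnerKolyvagin] §1.3 H.5(b) (arXiv:1202.6340 p. 7 L96–97), §1.6 (p. 12 L29–55), §2.2, Def. 3.1.2;
[CastellaGrossiLeeSkinner2022] §3.2, §3.4; [Brink2007] Thm. 2; [MazurRubinMemoirs2004] Def. 1.1.1.
-/

set_option linter.dupNamespace false
set_option autoImplicit false

noncomputable section

open scoped Classical Pointwise ContRepresentation TensorProduct NumberField

open Function NumberField IsDedekindDomain Field
open Literature Literature.NumberTheory.EllipticCurves WeierstrassCurve
open Literature.NumberTheory.GaloisCohomology Literature.NumberTheory.GaloisCohomology.Howard2004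
open Literature.NumberTheory.Automorphic
open Literature.NumberTheory.GaloisRepresentations Literature.NumberTheory.GaloisRepresentations.DiscreteGaloisModule
open Summit.BirchSwinnertonDyer.BirchSwinnertonDyer.Theorems

namespace Summit.BirchSwinnertonDyer.BirchSwinnertonDyer.Theorems.HeegnerMuPartH5bAtS

set_option synthInstance.maxHeartbeats 80000 in
/-- **One frame of `Stmt.h5bAtS` from its level-`0` clause at the places above `p` on that frame** (the per-frame form of
`h5bAtS_of_clauseZeroP`): on a frame `(N, W, K, p, κ, γ)` of the μ-letter with `Thm413Hypotheses`, `(irr_ℚ)`, `(irr_K)`, a place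
set `S ⊇ {v ∣ p}` inside `{v ∣ pN}` stable under `Aut(K/ℚ)`, IF every `v ∈ S` above `p` has a threshold beyond which the H.5(b)
clause holds at tower level `0` for all the data (`H5Pf`), THEN there is ONE `m₅` beyond which H.5(b) holds at every level `k`
and every `v ∈ S` for all the data.  `m₅ := max m₁^{∤p} (max_{v ∣ p} m₁(v)) + 1`.
[cite: Howard2004HeegnerKolyvagin, §1.3 H.5(b) (arXiv:1202.6340 p. 7 L96–97), §1.6 (p. 12 L29–55), §2.2, Def. 3.1.2]
[cite: CastellaGrossiLeeSkinner2022, §3.2 and §3.4] [cite: Brink2007, Thm. 2] -/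
theorem h5bAtS_frame_of_clauseZeroP
    (N : ℕ) [NeZero N] (W : WeierstrassCurve ℚ) [W.IsGloballyMinimal] (K : Type) [Field K] [NumberField K]
    (p : ℕ) [Fact p.Prime] (κ : ZpExtension K p) (γ : Field.absoluteGaloisGroup K)
    (hyp : CastellaGrossiLeeSkinner2022.Thm413Hypotheses N W K p κ γ)
    (_hirr : W.HasIrreducibleModPGaloisRep p) (_hirrK : (W.baseChange K).HasIrreducibleModPGaloisRep p)
    (S : Finset (HeightOneSpectrum (𝓞 K)))
    (hpS : ∀ v, ((p : ℕ) : 𝓞 K) ∈ v.asIdeal → v ∈ S)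
    (hbad : haveI := hyp.isElliptic
      ∀ v, v ∉ S → ((p : ℕ) : 𝓞 K) ∉ v.asIdeal → (W.baseChange K).HasGoodReductionAt v)
    (hSN : ∀ v ∈ S, ((p : ℕ) : 𝓞 K) ∈ v.asIdeal ∨ ((N : ℕ) : 𝓞 K) ∈ v.asIdeal)
    (hSσ : ∀ (σ : K ≃ₐ[ℚ] K) (v : HeightOneSpectrum (𝓞 K)), σ • v ∈ S → v ∈ S)
    (H5Pf : haveI := hyp.isElliptic
      ∀ v ∈ S, ((p : ℕ) : 𝓞 K) ∈ v.asIdeal →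
      ∃ m₁ : ℕ, ∀ (m : ℕ) (hm : 1 ≤ m), m₁ < m →
        letI := IwasawaAlgebra.isDomain_quotient_X_pow_add_C p hm
        letI := IwasawaAlgebra.isDiscreteValuationRing_quotient_X_pow_add_C p hm
        haveI := IwasawaAlgebra.EisensteinCoeff.isLocalRing_succ p hm
        letI := IwasawaAlgebra.EisensteinCoeff.algebraOfSpecSucc p m
        haveI := W.isScalarTower_algebraOfSpecSucc (K := K) (p := p) (m := m)
        letI := W.residueModuleSucc (K := K) (p := p) hm
        ∀ (π : ∀ v : HeightOneSpectrum (𝓞 K), TamePin v) (L : Set (HeightOneSpectrum (𝓞 K)))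
          (hL : L ⊆ (W.eisensteinTower (κ.unitTwist (-1)) hm).degreeTwoPrimes p) (hLS : ∀ v ∈ L, v ∉ S)
          (jbar' : AlgebraicClosure K →+* ℂ)
          (c₀ : absoluteGaloisGroup ℚ) (σ : K ≃ₐ[ℚ] K) (hσ₁ : σ ≠ 1) (hσ : σ * σ = 1)
          (hτl : IsLiftOfAut σ (absGaloisTransport (K := ℚ) (L := K) c₀).toRingEquiv)
          (hτ₂ : Function.Involutive (absGaloisTransport (K := ℚ) (L := K) c₀).toRingEquiv)
          (D : ∀ k, DualityDatum p (ConjugationDatum.ofLifts σ hσ₁ hσ _ hτl hτ₂)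
            ((W.eisensteinTower (κ.unitTwist (-1)) hm).ρ k) (IwasawaAlgebra.EisensteinCoeff p m (k + 1)))
          (e : ∀ j : ℕ, geomTorsion (W.baseChange K) ((p : ℤ) ^ j) →+ geomTorsion (W.baseChange K) ((p : ℤ) ^ j) →+
            MuCarrier K (p ^ j))
          (log : ∀ j : ℕ, MuCarrier K (p ^ j) →+ ZMod (p ^ j)),
          IsComplexConjugation (Rat.castHom ℝ) c₀ →
          (∀ x, (ConjugationDatum.ofLifts σ hσ₁ hσ _ hτl hτ₂).τ x = absGaloisTransport (K := ℚ) (L := K) c₀ x) →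
          (∀ k, (D k).e = ZpExtension.eisensteinDualityForm hm (k + 1)
            (conjPairing (e (k + 1)) ((ConjugationDatum.ofLifts σ hσ₁ hσ _ hτl hτ₂).isLift.torsionMap W _)
              (log (k + 1)))) →
          (∀ j a, e j a a = 0) →
          (∀ j (g : absoluteGaloisGroup K) a b, e j (g • a) (g • b) = mu K (p ^ j) g (e j a b)) →
          (∀ j a b, e j ((ConjugationDatum.ofLifts σ hσ₁ hσ _ hτl hτ₂).isLift.torsionMap W _ a)
            ((ConjugationDatum.ofLifts σ hσ₁ hσ _ hτl hτ₂).isLift.torsionMap W _ b) = -e j a b) →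
          (∀ j (a : geomTorsion (W.baseChange K) ((p : ℤ) ^ j)),
            (ConjugationDatum.ofLifts σ hσ₁ hσ _ hτl hτ₂).isLift.torsionMap W _
              ((ConjugationDatum.ofLifts σ hσ₁ hσ _ hτl hτ₂).isLift.torsionMap W _ a) = a) →
          (∀ j, Function.Bijective (log j)) →
          (∀ j (g : absoluteGaloisGroup K) ξ, log j (mu K (p ^ j) g ξ) = cyclotomicCharacterModPow K p j g * log j ξ) →
            (((W.isQuotientBy_eisensteinDVRSetting_πbar (κ.unitTwist (-1)) hm S hpS hbad L hL hLS jbar'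
                (ConjugationDatum.ofLifts σ hσ₁ hσ _ hτl hτ₂) D
                (W.eisensteinLevelsTameFs (κ.unitTwist (-1)) hm π S hpS hbad L hL hLS)
                0).propagateStructure (W.eisensteinTowerTriple (κ.unitTwist (-1)) hm S hpS hbad L hL hLS 0).cond)
                (Sum.inr (σ • v))).map
                (((W.residualTauGeomTorsion (p := p) (ConjugationDatum.ofLifts σ hσ₁ hσ _ hτl hτ₂) hm (k := 0 + 1)
                    (Nat.succ_pos 0)).thetaH1 (Sum.inr v)).comp
                  ((ConjugationDatum.ofLifts σ hσ₁ hσ _ hτl hτ₂).transportH1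
                    ((W.baseChange K).torsionGaloisModule (p : ℤ)) v)) =
              ((W.isQuotientBy_eisensteinDVRSetting_πbar (κ.unitTwist (-1)) hm S hpS hbad L hL hLS jbar'
                (ConjugationDatum.ofLifts σ hσ₁ hσ _ hτl hτ₂) D
                (W.eisensteinLevelsTameFs (κ.unitTwist (-1)) hm π S hpS hbad L hL hLS)
                0).propagateStructure (W.eisensteinTowerTriple (κ.unitTwist (-1)) hm S hpS hbad L hL hLS 0).cond)
                (Sum.inr v)) :
    haveI := hyp.isElliptic
    ∃ m₅ : ℕ, ∀ (m : ℕ) (hm : 1 ≤ m), m₅ ≤ m →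
      letI := IwasawaAlgebra.isDomain_quotient_X_pow_add_C p hm
      letI := IwasawaAlgebra.isDiscreteValuationRing_quotient_X_pow_add_C p hm
      haveI := IwasawaAlgebra.EisensteinCoeff.isLocalRing_succ p hm
      letI := IwasawaAlgebra.EisensteinCoeff.algebraOfSpecSucc p m
      haveI := W.isScalarTower_algebraOfSpecSucc (K := K) (p := p) (m := m)
      letI := W.residueModuleSucc (K := K) (p := p) hm
      ∀ (π : ∀ v : HeightOneSpectrum (𝓞 K), TamePin v) (L : Set (HeightOneSpectrum (𝓞 K)))
        (hL : L ⊆ (W.eisensteinTower (κ.unitTwist (-1)) hm).degreeTwoPrimes p) (hLS : ∀ v ∈ L, v ∉ S)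
        (jbar' : AlgebraicClosure K →+* ℂ)
        (c₀ : absoluteGaloisGroup ℚ) (σ : K ≃ₐ[ℚ] K) (hσ₁ : σ ≠ 1) (hσ : σ * σ = 1)
        (hτl : IsLiftOfAut σ (absGaloisTransport (K := ℚ) (L := K) c₀).toRingEquiv)
        (hτ₂ : Function.Involutive (absGaloisTransport (K := ℚ) (L := K) c₀).toRingEquiv)
        (D : ∀ k, DualityDatum p (ConjugationDatum.ofLifts σ hσ₁ hσ _ hτl hτ₂)
          ((W.eisensteinTower (κ.unitTwist (-1)) hm).ρ k) (IwasawaAlgebra.EisensteinCoeff p m (k + 1)))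
        (e : ∀ j : ℕ, geomTorsion (W.baseChange K) ((p : ℤ) ^ j) →+ geomTorsion (W.baseChange K) ((p : ℤ) ^ j) →+
          MuCarrier K (p ^ j))
        (log : ∀ j : ℕ, MuCarrier K (p ^ j) →+ ZMod (p ^ j)),
        IsComplexConjugation (Rat.castHom ℝ) c₀ →
        (∀ x, (ConjugationDatum.ofLifts σ hσ₁ hσ _ hτl hτ₂).τ x = absGaloisTransport (K := ℚ) (L := K) c₀ x) →
        (∀ k, (D k).e = ZpExtension.eisensteinDualityForm hm (k + 1)
          (conjPairing (e (k + 1)) ((ConjugationDatum.ofLifts σ hσ₁ hσ _ hτl hτ₂).isLift.torsionMap W _)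
            (log (k + 1)))) →
        (∀ j a, e j a a = 0) →
        (∀ j (g : absoluteGaloisGroup K) a b, e j (g • a) (g • b) = mu K (p ^ j) g (e j a b)) →
        (∀ j a b, e j ((ConjugationDatum.ofLifts σ hσ₁ hσ _ hτl hτ₂).isLift.torsionMap W _ a)
          ((ConjugationDatum.ofLifts σ hσ₁ hσ _ hτl hτ₂).isLift.torsionMap W _ b) = -e j a b) →
        (∀ j (a : geomTorsion (W.baseChange K) ((p : ℤ) ^ j)),
          (ConjugationDatum.ofLifts σ hσ₁ hσ _ hτl hτ₂).isLift.torsionMap W _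
            ((ConjugationDatum.ofLifts σ hσ₁ hσ _ hτl hτ₂).isLift.torsionMap W _ a) = a) →
        (∀ j, Function.Bijective (log j)) →
        (∀ j (g : absoluteGaloisGroup K) ξ, log j (mu K (p ^ j) g ξ) = cyclotomicCharacterModPow K p j g * log j ξ) →
        ∀ k, ∀ v ∈ S,
          (((W.isQuotientBy_eisensteinDVRSetting_πbar (κ.unitTwist (-1)) hm S hpS hbad L hL hLS jbar'
              (ConjugationDatum.ofLifts σ hσ₁ hσ _ hτl hτ₂) D
              (W.eisensteinLevelsTameFs (κ.unitTwist (-1)) hm π S hpS hbad L hL hLS)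
              k).propagateStructure (W.eisensteinTowerTriple (κ.unitTwist (-1)) hm S hpS hbad L hL hLS k).cond)
              (Sum.inr (σ • v))).map
              (((W.residualTauGeomTorsion (p := p) (ConjugationDatum.ofLifts σ hσ₁ hσ _ hτl hτ₂) hm (k := k + 1)
                  k.succ_pos).thetaH1 (Sum.inr v)).comp
                ((ConjugationDatum.ofLifts σ hσ₁ hσ _ hτl hτ₂).transportH1
                  ((W.baseChange K).torsionGaloisModule (p : ℤ)) v)) =
            ((W.isQuotientBy_eisensteinDVRSetting_πbar (κ.unitTwist (-1)) hm S hpS hbad L hL hLS jbar'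
              (ConjugationDatum.ofLifts σ hσ₁ hσ _ hτl hτ₂) D
              (W.eisensteinLevelsTameFs (κ.unitTwist (-1)) hm π S hpS hbad L hL hLS)
              k).propagateStructure (W.eisensteinTowerTriple (κ.unitTwist (-1)) hm S hpS hbad L hL hLS k).cond)
              (Sum.inr v) := by
  haveI := hyp.isElliptic
  have hK : IsImaginaryQuadratic K := hyp.isImaginaryQuadratic
  haveI : IsTotallyComplex K := hK.isTotallyComplex
  classical
  -- `κ⁻ = κ.unitTwist (-1)` is anticyclotomic; the places of `S` prime to `p` lie over `N`, hence are finitely decomposed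
  have hantiκ : (κ.unitTwist (-1)).IsAnticyclotomic := hyp.anticyclotomic.unitTwist (-1)
  have hdec : ∀ v ∈ S, ((p : ℕ) : 𝓞 K) ∉ v.asIdeal → ¬ (GreenbergSelmer.decomp v ≤ (κ.unitTwist (-1)).kerSubgroup) :=
    fun v hvS hpv ↦ ZpExtension.not_decomp_le_kerSubgroup_of_natCast_mem (κ.unitTwist (-1)) hK hantiκ hyp.heegner
      ((hSN v hvS).resolve_left hpv) hpv
  -- ONE threshold for the places prime to `p` (all conjugation data, all H.4 data, all slots)
  obtain ⟨m₁, hm₁⟩ :=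
    W.eisensteinDVRSetting_exists_forall_h5b_clause_zero_of_not_mem (κ.unitTwist (-1)) S hpS hbad hdec
  -- the thresholds of the hypothesis at the places above `p`
  choose! mP hmP using H5Pf
  refine ⟨max m₁ (S.sup mP) + 1, fun m hm hle ↦ ?_⟩
  letI := IwasawaAlgebra.isDomain_quotient_X_pow_add_C p hm
  letI := IwasawaAlgebra.isDiscreteValuationRing_quotient_X_pow_add_C p hm
  haveI := IwasawaAlgebra.EisensteinCoeff.isLocalRing_succ p hm
  letI := IwasawaAlgebra.EisensteinCoeff.algebraOfSpecSucc p m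
  haveI := W.isScalarTower_algebraOfSpecSucc (K := K) (p := p) (m := m)
  letI := W.residueModuleSucc (K := K) (p := p) hm
  intro π L hL hLS jbar' c₀ σ hσ₁ hσ hτl hτ₂ D e log hc₀ hτ hDe h4' h5' h6' h7' h8' h9'
  have hm₁m : m₁ < m := by omega
  -- every level `k` from level `0`
  refine W.eisensteinDVRSetting_h5b_hfin_of_zero (κ.unitTwist (-1)) hm S hpS hbad L hL hLS jbar' σ hσ₁ hσ _ hτl hτ₂ D
    (W.eisensteinLevelsTameFs (κ.unitTwist (-1)) hm π S hpS hbad L hL hLS) (fun v hvS ↦ ?_)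
  by_cases hpv : ((p : ℕ) : 𝓞 K) ∈ v.asIdeal
  · -- above `p`: the hypothesis
    have hmPv : mP v < m := lt_of_le_of_lt (Finset.le_sup (f := mP) hvS) (by omega)
    exact hmP v hvS hpv m hm hmPv π L hL hLS jbar' c₀ σ hσ₁ hσ hτl hτ₂ D e log hc₀ hτ hDe h4' h5' h6' h7' h8' h9'
  · -- prime to `p`: the uniform A4 clause on the frame
    have hanti : ∀ g : absoluteGaloisGroup K,
        ((κ.unitTwist (-1)) ((ConjugationDatum.ofLifts σ hσ₁ hσ _ hτl hτ₂).conj g)).toAdd =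
          -((κ.unitTwist (-1)) g).toAdd :=
      fun g ↦ ZpExtension.toAdd_conjGalCMH_eq_neg (κ.unitTwist (-1)) hantiκ (fun w ↦ IsTotallyComplex.isComplex w)
        (ConjugationDatum.ofLifts σ hσ₁ hσ _ hτl hτ₂).isLift hc₀ hτ g
    have hSσ' : ∀ w ∈ S, (ConjugationDatum.ofLifts σ hσ₁ hσ _ hτl hτ₂).σ • w ∈ S := fun w hw ↦
      hSσ σ _ (by change σ • σ • w ∈ S; rwa [smul_smul, hσ, one_smul])
    exact hm₁ m hm hm₁m L hL hLS jbar' (ConjugationDatum.ofLifts σ hσ₁ hσ _ hτl hτ₂) D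
      (W.eisensteinLevelsTameFs (κ.unitTwist (-1)) hm π S hpS hbad L hL hLS) hanti hSσ' v hvS hpv

end Summit.BirchSwinnertonDyer.BirchSwinnertonDyer.Theorems.HeegnerMuPartH5bAtS

end
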